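import Literature.AlgebraicGeometry.HodgeTheory.AlgebraicClasses
import Literature.AlgebraicGeometry.HodgeTheory.GysinFormalismCorrespondences
import Mathlib.AlgebraicGeometry.Morphisms.QuasiFinite
import HarnessLib

/-!
# Pull-back along a quasi-finite morphism of equidimensional smooth projective varieties preserves the support filtration `Nᶜ Hᵃ(–(ℂ); ℂ)`

Family `hodge`, layer `Literature/AlgebraicGeometry/HodgeTheory`. PROOF FILE (theorems only: no
definition, no named fact). Companion of `map_mem_supportedClasses_of_flat`
(`HodgeTheory/HodgeConjectureQbarVoisinProofs`: FLAT pull-backs preserve `Nᶜ Hᵃ`, because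
codimension does not drop along flat morphisms, Hartshorne III Prop. 9.5) for the other standard
class of morphisms along which codimension does not drop: (locally) QUASI-FINITE morphisms
`f : Y ⟶ X` between smooth projective varieties OF THE SAME DIMENSION `n` — e.g. finite surjective
morphisms such as the level map `Xⁿ_{km} → Xⁿₘ` of the Fermat hypersurfaces (Shioda–Katsura 1979
§1), for which it gives the pull-back of algebraic classes (Fulton, *Intersection Theory*,
Cor. 19.2 (b), in this special case) without any cycle-class or moving machinery. PROVED here:

* `strictMono_base_of_locallyQuasiFinite` — **incomparability**: a locally quasi-finite morphism
  of schemes is strictly monotone for the specialisation orders (a strict specialisation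
  `y ⤳ y'`, `y ≠ y'`, has `f y ≠ f y'`: the fibre `f⁻¹{f y'}` is discrete, Mathlib
  `Scheme.Hom.isDiscrete_preimage_singleton`, and an open set isolating `y'` in it contains the
  generisation `y`); Atiyah–Macdonald Cor. 5.9 for integral extensions;
* `height_le_height_base_of_locallyQuasiFinite` — hence **the dimension of a point does not drop**:
  `dim {y}⁻ ≤ dim {f y}⁻` (strict chains of specialisations map to strict chains);
* `coheight_base_le_of_locallyQuasiFinite` — between smooth projective varieties of the same
  dimension `n` (`dim + codim = n` on both, Hartshorne II Ex. 3.20 (d), the tree's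
  `exists_height_eq_coheight_eq`) **codimension does not drop on preimages**: `codim f(y) ≤ codim y`;
* `map_mem_supportedClasses_of_locallyQuasiFinite`, `supportedClasses_le_comap_map_of_locallyQuasiFinite`,
  `map_mem_algebraicClasses_of_locallyQuasiFinite` — so `f^*(Nᶜ Hᵃ(X)) ⊆ Nᶜ Hᵃ(Y)` and in particular
  `f^*(algebraicClasses X p) ⊆ algebraicClasses Y p`: a class dying off a Zariski-closed `Z` of
  codimension `≥ c` pulls back to a class dying off `f⁻¹Z` (`complexBetti.restrictCompl_map_eq_zero`),
  closed of codimension `≥ c` (the proof of `map_mem_supportedClasses_of_flat` verbatim, with the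
  codimension estimate above in place of `coheight_base_le_of_flat`).

Finite morphisms are locally quasi-finite (Mathlib instance), so every statement applies to
`[IsFinite f.left]`. Not treated: morphisms between varieties of different dimensions (there the
estimate is `codim f(y) ≤ codim y + (dim X - dim Y)`, cf. `le_coheight_of_mem_image`).

## References

* [GrothendieckTopology1969] A. Grothendieck, *Hodge's general conjecture is false for trivial
  reasons*, Topology 8 (1969), §1 (functoriality of the filtration by codimension of support).
* [AtiyahMacdonald1969] M. F. Atiyah, I. G. Macdonald, *Introduction to Commutative Algebra* (1969),
  Cor. 5.9 (incomparability).
* [Hartshorne1977] R. Hartshorne, *Algebraic Geometry* (1977), II Ex. 3.5 (a) (finite ⟹ quasi-finite),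
  II Ex. 3.20 (d) (`dim + codim`).
* [Fulton1998] W. Fulton, *Intersection Theory*, 2nd ed. (1998), Cor. 19.2 (b) (cite-only: the
  general pull-back of algebraic classes, of which this is the quasi-finite equidimensional case).
-/

noncomputable section

open CategoryTheory AlgebraicGeometry

namespace Literature.AlgebraicGeometry.HodgeTheory

/-! ### Incomparability: quasi-finite morphisms are strictly monotone on points -/

section QuasiFinite

/-- **Incomparability for locally quasi-finite morphisms.** A locally quasi-finite morphism of
schemes `f : X ⟶ Y` is strictly monotone for the specialisation preorders (`a ≤ b ↔ b ⤳ a`): if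
`b ⤳ a` then `f b ⤳ f a` (continuity), and if moreover `f a ⤳ f b` then `f a = f b` (schemes are
`T₀`), so `a, b` lie in the discrete fibre `f⁻¹{f b}` (Mathlib `Scheme.Hom.isDiscrete_preimage_singleton`);
an open set cutting `{a}` out of the fibre contains the generisation `b` of `a`, whence `a = b`.
For `Spec` of an integral extension this is Cohen–Seidenberg incomparability.
[cite: AtiyahMacdonald1969, Cor. 5.9] -/
theorem strictMono_base_of_locallyQuasiFinite {X Y : Scheme} (f : X ⟶ Y) [LocallyQuasiFinite f] :
    StrictMono f.base := by
  intro a b hab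
  have hba : b ⤳ a := Scheme.le_iff_specializes.mp hab.le
  refine lt_iff_le_not_ge.mpr ⟨Scheme.le_iff_specializes.mpr (hba.map f.continuous), fun hge ↦ ?_⟩
  have heq : f.base a = f.base b :=
    ((hba.map f.continuous).antisymm (Scheme.le_iff_specializes.mp hge)).eq.symm
  have hd := f.isDiscrete_preimage_singleton (f.base b)
  obtain ⟨u, hu, hua⟩ := (isDiscrete_iff_forall_mem_exists_isOpen.mp hd) a (by simpa using heq)
  have hb : b ∈ u ∩ f.base ⁻¹' {f.base b} :=
    ⟨hba.mem_open hu (by simpa using (Set.ext_iff.mp hua a).mpr rfl |>.1), rfl⟩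
  rw [hua] at hb
  exact hab.ne' hb

/-- **The dimension of points does not drop along a locally quasi-finite morphism**:
`dim {x}⁻ ≤ dim {f x}⁻`, i.e. `Order.height x ≤ Order.height (f x)` in the specialisation orders
(strict chains of specialisations of `x` map to strict chains of specialisations of `f x`,
`strictMono_base_of_locallyQuasiFinite`). [cite: AtiyahMacdonald1969, Cor. 5.9] -/
theorem height_le_height_base_of_locallyQuasiFinite {X Y : Scheme} (f : X ⟶ Y)
    [LocallyQuasiFinite f] (x : X) : Order.height x ≤ Order.height (f.base x) :=
  Order.height_le_height_apply_of_strictMono _ (strictMono_base_of_locallyQuasiFinite f) x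

end QuasiFinite

/-! ### Codimension and supported classes along quasi-finite morphisms of equidimensional smooth projective varieties -/

section HodgeTheory

variable {n : ℕ} {Y X : Motives.SchemeOver ℂ}

/-- **Codimension does not drop on preimages along a quasi-finite morphism between smooth
projective varieties of the same dimension**: `codim f(y) ≤ codim y`. On both sides
`dim + codim = n` (`exists_height_eq_coheight_eq`), and `dim {y}⁻ ≤ dim {f y}⁻`
(`height_le_height_base_of_locallyQuasiFinite`). [cite: Hartshorne1977, II Ex. 3.20 (d)] -/
theorem coheight_base_le_of_locallyQuasiFinite (hY : Motives.IsSmoothProjective n Y)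
    (hX : Motives.IsSmoothProjective n X) (f : Y ⟶ X) [LocallyQuasiFinite f.left] (y : Y.left) :
    Order.coheight (f.left.base y) ≤ Order.coheight y := by
  obtain ⟨a, c, ha, hc, hac⟩ := exists_height_eq_coheight_eq hY y
  obtain ⟨a', c', ha', hc', hac'⟩ := exists_height_eq_coheight_eq hX (f.left.base y)
  have h1 := height_le_height_base_of_locallyQuasiFinite f.left y
  rw [ha, ha'] at h1
  have h1' : a ≤ a' := by exact_mod_cast h1
  rw [hc, hc']
  exact_mod_cast (show c' ≤ c by omega)

/-- **Quasi-finite pull-back respects the support filtration** between smooth projective varieties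
of the same dimension: `f^*(Nᶜ Hᵃ(X(ℂ); ℂ)) ⊆ Nᶜ Hᵃ(Y(ℂ); ℂ)` — a class vanishing on `(X ∖ Z)(ℂ)`,
`Z` Zariski-closed of codimension `≥ c`, pulls back to a class vanishing on `(Y ∖ f⁻¹Z)(ℂ)`
(`complexBetti.restrictCompl_map_eq_zero`), and every point of the closed `f⁻¹Z` has codimension
`≥ c` (`coheight_base_le_of_locallyQuasiFinite`). The proof of `map_mem_supportedClasses_of_flat`
with the quasi-finite codimension estimate. [cite: GrothendieckTopology1969, §1] -/
theorem map_mem_supportedClasses_of_locallyQuasiFinite (hY : Motives.IsSmoothProjective n Y)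
    (hX : Motives.IsSmoothProjective n X) (f : Y ⟶ X) [LocallyQuasiFinite f.left]
    {a c : ℕ} {x : complexBetti X a} (hx : x ∈ supportedClasses X a c) :
    complexBetti.map f a x ∈ supportedClasses Y a c := by
  suffices h : supportedClasses X a c ≤
      (supportedClasses Y a c).comap (complexBetti.map f a).hom from h hx
  refine iSup_le fun S ↦ iSup_le fun hS ↦ iSup_le fun hc ↦ fun z hz ↦ ?_
  rw [LinearMap.mem_ker] at hz
  refine mem_supportedClasses_of_restrictCompl_eq_zero (hS.preimage f.left.base.hom.continuous)
    (fun w hw ↦ (hc _ hw).trans (coheight_base_le_of_locallyQuasiFinite hY hX f w)) ?_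
  exact complexBetti.restrictCompl_map_eq_zero f hz

/-- Submodule form: `Nᶜ Hᵃ(X) ≤ (f^*)⁻¹ Nᶜ Hᵃ(Y)` for `f` locally quasi-finite between smooth
projective varieties of the same dimension. [cite: GrothendieckTopology1969, §1] -/
theorem supportedClasses_le_comap_map_of_locallyQuasiFinite (hY : Motives.IsSmoothProjective n Y)
    (hX : Motives.IsSmoothProjective n X) (f : Y ⟶ X) [LocallyQuasiFinite f.left] (a c : ℕ) :
    supportedClasses X a c ≤ (supportedClasses Y a c).comap (complexBetti.map f a).hom :=
  fun _ hx ↦ map_mem_supportedClasses_of_locallyQuasiFinite hY hX f hx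

/-- **Quasi-finite pull-back preserves algebraic classes** (`Nᵖ H²ᵖ`) between smooth projective
varieties of the same dimension: `f^*(algebraicClasses X p) ⊆ algebraicClasses Y p` — the
quasi-finite equidimensional case (e.g. finite surjective morphisms) of the pull-back of algebraic
classes `f^* cl(Z) = cl(f^* Z)`. [cite: GrothendieckTopology1969, §1] [cite: Fulton1998, §19.2 Cor. 19.2 (b)] -/
theorem map_mem_algebraicClasses_of_locallyQuasiFinite (hY : Motives.IsSmoothProjective n Y)
    (hX : Motives.IsSmoothProjective n X) (f : Y ⟶ X) [LocallyQuasiFinite f.left]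
    {p : ℕ} {x : complexBetti X (2 * p)} (hx : x ∈ algebraicClasses X p) :
    complexBetti.map f (2 * p) x ∈ algebraicClasses Y p :=
  map_mem_supportedClasses_of_locallyQuasiFinite hY hX f hx

end HodgeTheory

end Literature.AlgebraicGeometry.HodgeTheory

end
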